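import Summits.BirchSwinnertonDyer.BirchSwinnertonDyer.Theses.AlignedTransportAtTwo
import Summits.BirchSwinnertonDyer.BirchSwinnertonDyer.Theorems.ByReductionTypeAtTwoAnalyticMuZeroAtTwoHolds
import HarnessLib

/-!
# Route `AlignedTransportAtTwo` — the analytic `μ₂ = 0` binder of the cruxes C1 / C2 and of the residual R is IDLE:
# each crux is EQUIVALENT to its restatement without that binder (`F1Sign2.AnalyticMuZeroAtTwo` is a tree theorem, p641779)

Cell `bsd-f1-sign2`, WIDTH-5 attach seat `bsd-line-att-p3` g10 (item of record: crux C2 `MainConjectureOfRankZeroBSDAtTwo`,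
stmt-BirchSwinnertonDyer-22298; lead `bsd-line-att-p2` WAKE-only). THEOREMS ONLY; nothing asserted; `--supports stmt-BirchSwinnertonDyer-22298`.
BSD is NOT proved; no crux is closed; the lead's verdict for C2 («blocked-on `Rank1Residual.GreenbergMuConjectureIrreducible`») is unchanged.

WHAT CHANGED (2026-08-28T14:49Z, cell `bsd-2adic`, seat `bsd-2adic-tower-1`, p641779): `F1Sign2.AnalyticMuZeroAtTwo` — analytic `μ = 0` at `2`
(`red G ≠ 0` for every integral lift `G` of `L₂(f, α)`) for EVERY globally minimal `W/ℚ` good ordinary at `2` without a rational `2`-torsion abscissa —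
is PROVED (`…Theorems.AnalyticMuTwo.analyticMuZeroAtTwo_holds`), and in the `IsEvenBranchLiftAtTwo` currency of this route's statements
(`…AnalyticMuTwo.red_ne_zero_of_isEvenBranchLiftAtTwo_of_forall_not_hasRationalTwoTorsionX`). The three statements of route
`route-BirchSwinnertonDyer-AlignedTransportAtTwo` that carry the binder
`hμan : ∀ ⦃N⦄ [NeZero N] (f : CuspForm (Gamma0 N) 2), IsNewformOf W f → ∀ G, IsEvenBranchLiftAtTwo W f G → red G ≠ 0`
for a curve `W` that is ALSO assumed good ordinary at `2` with no rational `2`-torsion abscissa therefore do not depend on it: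

* §1 `mainConjectureOfRankZeroBSDAtTwo_iff_muFree` — C2 (stmt-22298) ⟺ «∀ globally minimal non-CM `W`, good ordinary at `2`, no rational
  `2`-torsion abscissa, `Δ ∉ ℚ²`, `r_an = 0`, `BSD(W,2)` ⟹ `MazurMainConjecture W 2`» (the crux with `hμan` deleted); both projections named.
* §2 `mainConjectureTransportAlignedAtTwo_iff_muFree` — C1 (stmt-22296) ⟺ C1 with the binder `hμan₁` on `W₁` deleted (the lead att-p1 g8 already
  consumes the theorem inside line `birth` v20, `…TwistReachLambda`; this is the crux-level statement of the same fact).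
* §3 `offAlignedSeedCellAtTwo_iff_muFree` — the residual R (stmt-22996): inside its excluded configuration the clause «`W′` has analytic `μ₂ = 0`»
  is AUTOMATIC (`W′` is good ordinary at `2` without rational `2`-torsion abscissa there), so R ⟺ R with that conjunct deleted — the excluded
  configuration is LARGER as printed without it, i.e. R-without is formally the weaker demand and still equivalent.
Reading for the planner (-imc, planner-of-record): at the next restatement the `hμan` binders of #1/#2 and the `hμan′` conjunct of #5 can be dropped
without changing the items' strength (certified here by `Iff`); until then every consumer may feed
`AnalyticMuTwo.red_ne_zero_of_isEvenBranchLiftAtTwo_of_forall_not_hasRationalTwoTorsionX W hord ht` for the binder.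

References: [GreenbergLNM1716] §1 Conj. 1.11; [GreenbergVatsal2000] Thm. 1.4 (the analytic `μ`/`λ` transport this route reads at `p = 2`);
[Kato2004Asterisque] Thm. 17.4.
-/

set_option autoImplicit false
-- the route's Theorems namespace repeats a component by design (summit = sub-problem, D-0017).
set_option linter.dupNamespace false

noncomputable section

open scoped Classical MatrixGroups ModularForm

open CongruenceSubgroup WeierstrassCurve Literature.NumberTheory.EllipticCurves
  Literature.NumberTheory.EllipticCurves.ModularForms Literature.NumberTheory.EllipticCurves.Greenberg1999
  Summit.BirchSwinnertonDyer.Rank1Residual Summit.BirchSwinnertonDyer.Rank1Residual.F1Sign2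
  Summit.BirchSwinnertonDyer.Rank1Residual.X1.MuLambda
  Summit.BirchSwinnertonDyer.BirchSwinnertonDyer.Theorems.Rank1ResidualX1Defs
  Summit.BirchSwinnertonDyer.BirchSwinnertonDyer.Theses.AlignedTransportAtTwo
  Summit.BirchSwinnertonDyer.BirchSwinnertonDyer.Theorems.AnalyticMuTwo

namespace Summit.BirchSwinnertonDyer.BirchSwinnertonDyer.Theorems.AlignedTransportAtTwoAnalyticMuDischarge

/-! ## §1 Crux C2 `MainConjectureOfRankZeroBSDAtTwo` (stmt-BirchSwinnertonDyer-22298) -/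

/-- **C2 without its analytic-`μ` binder implies C2** (trivial projection: the extra hypothesis is discarded). [folklore] -/
theorem mainConjectureOfRankZeroBSDAtTwo_of_muFree
    (h : ∀ (W : WeierstrassCurve ℚ) [W.IsElliptic] [W.IsGloballyMinimal], ¬ W.HasCM → IsOrdinaryAt W 2 →
      (∀ x : ℚ, ¬ HasRationalTwoTorsionX W x) → ¬ IsSquare W.Δ → W.analyticRank = 0 → BSDp W 2 → MazurMainConjecture W 2) :
    MainConjectureOfRankZeroBSDAtTwo :=
  fun W _ _ hcm hord ht hsq hr _ hbsd => h W hcm hord ht hsq hr hbsd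

/-- **C2 implies C2 without its analytic-`μ` binder**: on the seed cell the binder `hμan` is supplied by the tree theorem
`AnalyticMuTwo.red_ne_zero_of_isEvenBranchLiftAtTwo_of_forall_not_hasRationalTwoTorsionX` (analytic `μ₂ = 0` at a good ordinary `2` with
`E[2]` irreducible, p641779). [cite: GreenbergLNM1716, §1 Conj. 1.11 (posed for all p; the p = 2 analytic reading is the cell's)] -/
theorem muFree_of_mainConjectureOfRankZeroBSDAtTwo (h : MainConjectureOfRankZeroBSDAtTwo) :
    ∀ (W : WeierstrassCurve ℚ) [W.IsElliptic] [W.IsGloballyMinimal], ¬ W.HasCM → IsOrdinaryAt W 2 →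
      (∀ x : ℚ, ¬ HasRationalTwoTorsionX W x) → ¬ IsSquare W.Δ → W.analyticRank = 0 → BSDp W 2 → MazurMainConjecture W 2 :=
  fun W _ _ hcm hord ht hsq hr hbsd =>
    h W hcm hord ht hsq hr (red_ne_zero_of_isEvenBranchLiftAtTwo_of_forall_not_hasRationalTwoTorsionX W hord ht) hbsd

/-- **C2 ⟺ C2 without the analytic-`μ` binder (the binder is IDLE).** Modulo nothing: `MainConjectureOfRankZeroBSDAtTwo` is equivalent to
«for every globally minimal non-CM `W/ℚ`, good ordinary at `2`, with no rational `2`-torsion abscissa, `Δ ∉ ℚ²`, `r_an = 0` and `BSD(W,2)`: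
`MazurMainConjecture W 2`». Restatement advisory for the planner; the crux's difficulty (Greenberg's `μ`-conjecture at `2`) is untouched.
[cite: GreenbergLNM1716, §1 Conj. 1.11] -/
theorem mainConjectureOfRankZeroBSDAtTwo_iff_muFree :
    MainConjectureOfRankZeroBSDAtTwo ↔
      ∀ (W : WeierstrassCurve ℚ) [W.IsElliptic] [W.IsGloballyMinimal], ¬ W.HasCM → IsOrdinaryAt W 2 →
        (∀ x : ℚ, ¬ HasRationalTwoTorsionX W x) → ¬ IsSquare W.Δ → W.analyticRank = 0 → BSDp W 2 → MazurMainConjecture W 2 :=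
  ⟨muFree_of_mainConjectureOfRankZeroBSDAtTwo, mainConjectureOfRankZeroBSDAtTwo_of_muFree⟩

/-! ## §2 Crux C1 `MainConjectureTransportAlignedAtTwo` (stmt-BirchSwinnertonDyer-22296) -/

/-- **C1 ⟺ C1 without the analytic-`μ` binder on `W₁` (the binder is IDLE):** `W₁` is good ordinary at `2` with no rational `2`-torsion
abscissa, so `hμan₁` is the tree theorem `AnalyticMuTwo.red_ne_zero_of_isEvenBranchLiftAtTwo_of_forall_not_hasRationalTwoTorsionX W₁`.
[cite: GreenbergVatsal2000, Thm. 1.4 (the transport statement this crux reads at p = 2)] -/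
theorem mainConjectureTransportAlignedAtTwo_iff_muFree :
    MainConjectureTransportAlignedAtTwo ↔
      ∀ (W₁ : WeierstrassCurve ℚ) [W₁.IsElliptic] [W₁.IsGloballyMinimal] (W₂ : WeierstrassCurve ℚ) [W₂.IsElliptic] [W₂.IsGloballyMinimal],
        IsOrdinaryAt W₁ 2 → IsOrdinaryAt W₂ 2 → (∀ x : ℚ, ¬ HasRationalTwoTorsionX W₁ x) → (∀ x : ℚ, ¬ HasRationalTwoTorsionX W₂ x) →
        ¬ IsSquare W₂.Δ → ∀ (F : Type) [Field F] [NumberField F], Module.finrank ℚ F = 3 → ∀ e₁ e₂ : F,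
        Polynomial.aeval e₁ (twoDivisionUCubic W₁) = 0 → Polynomial.aeval e₂ (twoDivisionUCubic W₂) = 0 → AlignedAtTwo F e₁ e₂ →
        AlignedAtInfinity F (twoDivisionUCubic W₁) (twoDivisionUCubic W₂) e₁ e₂ →
        MazurMainConjecture W₁ 2 → MazurMainConjecture W₂ 2 :=
  ⟨fun h W₁ _ _ W₂ _ _ hord₁ hord₂ ht₁ ht₂ hsq F _ _ hF e₁ e₂ he₁ he₂ hal hinf hMC =>
      h W₁ W₂ hord₁ hord₂ ht₁ ht₂ hsq F hF e₁ e₂ he₁ he₂ hal hinf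
        (red_ne_zero_of_isEvenBranchLiftAtTwo_of_forall_not_hasRationalTwoTorsionX W₁ hord₁ ht₁) hMC,
   fun h W₁ _ _ W₂ _ _ hord₁ hord₂ ht₁ ht₂ hsq F _ _ hF e₁ e₂ he₁ he₂ hal hinf _ hMC =>
      h W₁ W₂ hord₁ hord₂ ht₁ ht₂ hsq F hF e₁ e₂ he₁ he₂ hal hinf hMC⟩

/-! ## §3 Residual R `OffAlignedSeedCellAtTwo` (stmt-BirchSwinnertonDyer-22996) -/

/-- **Inside R's excluded configuration the clause «`W′` has analytic `μ₂ = 0`» is automatic:** the seed `W′` there is good ordinary at `2`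
with no rational `2`-torsion abscissa, so the existential with and without that conjunct are equivalent.
[cite: GreenbergLNM1716, §1 Conj. 1.11] -/
theorem exists_seed_iff_muFree (W : WeierstrassCurve ℚ) :
    (∃ (W' : WeierstrassCurve ℚ) (_ : W'.IsElliptic) (_ : W'.IsGloballyMinimal), ¬ W'.HasCM ∧ IsOrdinaryAt W' 2 ∧
        (∀ x : ℚ, ¬ HasRationalTwoTorsionX W' x) ∧ ¬ IsSquare W'.Δ ∧ W'.analyticRank = 0 ∧ BSDp W' 2 ∧
        (∀ ⦃N' : ℕ⦄ [NeZero N'] (f' : CuspForm (Gamma0 N') 2), IsNewformOf W' f' →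
          ∀ G' : IwasawaAlgebra 2, IsEvenBranchLiftAtTwo W' f' G' → red G' ≠ 0) ∧
        ∃ (F : Type) (_ : Field F) (_ : NumberField F), Module.finrank ℚ F = 3 ∧ ∃ e' e : F,
          Polynomial.aeval e' (twoDivisionUCubic W') = 0 ∧ Polynomial.aeval e (twoDivisionUCubic W) = 0 ∧ AlignedAtTwo F e' e ∧
          AlignedAtInfinity F (twoDivisionUCubic W') (twoDivisionUCubic W) e' e) ↔
    (∃ (W' : WeierstrassCurve ℚ) (_ : W'.IsElliptic) (_ : W'.IsGloballyMinimal), ¬ W'.HasCM ∧ IsOrdinaryAt W' 2 ∧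
        (∀ x : ℚ, ¬ HasRationalTwoTorsionX W' x) ∧ ¬ IsSquare W'.Δ ∧ W'.analyticRank = 0 ∧ BSDp W' 2 ∧
        ∃ (F : Type) (_ : Field F) (_ : NumberField F), Module.finrank ℚ F = 3 ∧ ∃ e' e : F,
          Polynomial.aeval e' (twoDivisionUCubic W') = 0 ∧ Polynomial.aeval e (twoDivisionUCubic W) = 0 ∧ AlignedAtTwo F e' e ∧
          AlignedAtInfinity F (twoDivisionUCubic W') (twoDivisionUCubic W) e' e) := by
  constructor
  · rintro ⟨W', hE, hM, hcm, hord, ht, hsq, hr, hbsd, -, hrest⟩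
    exact ⟨W', hE, hM, hcm, hord, ht, hsq, hr, hbsd, hrest⟩
  · rintro ⟨W', hE, hM, hcm, hord, ht, hsq, hr, hbsd, hrest⟩
    exact ⟨W', hE, hM, hcm, hord, ht, hsq, hr, hbsd,
      red_ne_zero_of_isEvenBranchLiftAtTwo_of_forall_not_hasRationalTwoTorsionX W' hord ht, hrest⟩

/-- **R ⟺ R without the analytic-`μ` conjunct on the seed `W′` (the conjunct is IDLE).** The residual `OffAlignedSeedCellAtTwo` is equivalent
to the same statement whose excluded rank-one configuration asks only for an ALIGNED rank-zero seed `W′` with `BSD(W′,2)` (non-CM, good ordinary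
at `2`, no rational `2`-torsion abscissa, `Δ′ ∉ ℚ²`, `r_an = 0`) — no analytic `μ₂(W′) = 0` clause. Restatement advisory; nothing closed.
[cite: GreenbergLNM1716, §1 Conj. 1.11] -/
theorem offAlignedSeedCellAtTwo_iff_muFree :
    OffAlignedSeedCellAtTwo ↔
      ∀ (W : WeierstrassCurve ℚ) [W.IsElliptic] [W.IsGloballyMinimal], ¬ W.HasCM → W.analyticRank ≤ 1 →
        ¬ (W.analyticRank = 0 ∧ Rank1Residual.GoodSS W 2 ∧ W.frobeniusTrace 2 = 0 ∧
            ∃ (A : WeierstrassCurve ℚ) (_ : A.IsElliptic) (_ : A.IsGloballyMinimal), A.HasCM ∧ A.analyticRank = 0 ∧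
              Rank1Residual.GoodSS A 2 ∧ A.frobeniusTrace 2 = 0 ∧
              ∃ e : WeierstrassCurve.geomTorsion W (2 : ℤ) ≃+ WeierstrassCurve.geomTorsion A (2 : ℤ),
                ∀ (σ : Field.absoluteGaloisGroup ℚ) (P : WeierstrassCurve.geomTorsion W (2 : ℤ)), e (σ • P) = σ • e P) →
        ¬ (W.analyticRank = 1 ∧ IsOrdinaryAt W 2 ∧ (∀ x : ℚ, ¬ HasRationalTwoTorsionX W x) ∧ ¬ IsSquare W.Δ ∧
            (∀ [NeZero (W.conductorNorm ℤ)] (f : CuspForm (Gamma0 (W.conductorNorm ℤ)) 2), IsNewformOf W f →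
              (padicLFunction f (unitRoot W 2 : ℚ_[2])).order = 1) ∧
            ∃ (W' : WeierstrassCurve ℚ) (_ : W'.IsElliptic) (_ : W'.IsGloballyMinimal), ¬ W'.HasCM ∧ IsOrdinaryAt W' 2 ∧
              (∀ x : ℚ, ¬ HasRationalTwoTorsionX W' x) ∧ ¬ IsSquare W'.Δ ∧ W'.analyticRank = 0 ∧ BSDp W' 2 ∧
              ∃ (F : Type) (_ : Field F) (_ : NumberField F), Module.finrank ℚ F = 3 ∧ ∃ e' e : F,
                Polynomial.aeval e' (twoDivisionUCubic W') = 0 ∧ Polynomial.aeval e (twoDivisionUCubic W) = 0 ∧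
                AlignedAtTwo F e' e ∧ AlignedAtInfinity F (twoDivisionUCubic W') (twoDivisionUCubic W) e' e) →
        BSDp W 2 := by
  refine forall_congr' fun W => forall_congr' fun _ => forall_congr' fun _ => forall_congr' fun _ => forall_congr' fun _ =>
    forall_congr' fun _ => ?_
  refine imp_congr_left (not_congr (and_congr_right fun _ => and_congr_right fun _ => and_congr_right fun _ =>
    and_congr_right fun _ => and_congr_right fun _ => exists_seed_iff_muFree W))

end Summit.BirchSwinnertonDyer.BirchSwinnertonDyer.Theorems.AlignedTransportAtTwoAnalyticMuDischarge

end
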